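import Mathlib
import Summits.KontsevichZagierPeriods.Zeta5Search.Families.DualQSeries
import Summits.KontsevichZagierPeriods.Zeta5Search.Families.DualQBridge
import HarnessLib
import HarnessLib.Audit

/-!
# ζ(5) search — Families: Brown–Zudilin's `|Q|` is the series coefficient `Gz` on the WHOLE cone `bzNum ≥ 0`

HONEST FRAMING: systematic search; no irrationality claim unless certified.  Cell `pub-zeta5`, certifier 2
(cert-2 g8, 2026-08-22).  Identities between integers; nothing about `ζ(5)`.

`Families/DualQBridge.abs_Qcoeff_eq_G` needs `e₁ = q₃−p₀−p₆+p₂+p₄ ≥ 0`.  Here the hypothesis is removed by passing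
to the series family `Gz` of `Families/DualQSeries` (`(1+v)^{e₁}`, `e₁ ∈ ℤ`):

* `zchoose_succ_left` — Pascal's rule for the tree's truncated binomial `zchoose` with non-negative upper index;
* `abs_Qcoeff_rel` — the sum (17) satisfies, for `q₃ ≥ 0` (0-based `q 2`), the same three-term relation as `Gz` in
  `e₁`: `|Q(p[p₃−1]; q[q₂+1])| = |Q(p;q)| + |Q(p[p₃−1]; q)|` (on the support of the summand the upper index of the
  central binomial is `≥ q₂ ≥ 0`, so the truncation of `zchoose` never interferes);
* **`abs_Qcoeff_eq_Gz`**: `|Q(p;q)| = Gz e₁ (e(p,q)) (t(p,q))` for `p₂, p₄ ≥ 0`, `q ≥ 0` and ANY sign of `e₁`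
  (for `e₁ < 0` by the same double induction as `Gz_eq_PhiZ_neg`);
* **`abs_QOf_eq_Gz`**: on Brown–Zudilin's family, `bzNum a ≥ 0` alone gives `|Q(a)| = Gz (h₂₇ a) (e(a)) (t(a))`.
-/

noncomputable section

open Finset

namespace Summit.KontsevichZagierPeriods.Zeta5Search.Families.Cellular

namespace DualQ

open Literature.NumberTheory.Irrationality
open Literature.NumberTheory.Irrationality.BrownZudilin2022 (zchoose Qcoeff QOf pOf qOf)
open Summit.KontsevichZagierPeriods.Zeta5Search.WedgeDictionary (zchoose_eq_zero)
open DualR (Gz Gz_succ Gz_update0 Gz_natCast Gz_eq_zero_of_neg)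

/-! ## Pascal for `zchoose` and the three-term relation of (17) -/

/-- Pascal's rule for `zchoose` with a non-negative upper index: `C(n+1,m) = C(n,m) + C(n,m−1)` (all `m ∈ ℤ`). -/
theorem zchoose_succ_left {n : ℤ} (hn : 0 ≤ n) (m : ℤ) : zchoose (n + 1) m = zchoose n m + zchoose n (m - 1) := by
  by_cases hm : m < 0
  · rw [zchoose_eq_zero (Or.inl (by omega)), zchoose_eq_zero (Or.inl hm), zchoose_eq_zero (Or.inl (by omega)), add_zero]
  by_cases hm0 : m = 0
  · subst hm0
    rw [zchoose_of_nonneg (by omega) le_rfl, zchoose_of_nonneg hn le_rfl, zchoose_eq_zero (Or.inl (by omega))]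
    simp
  by_cases hmn : m ≤ n
  · rw [zchoose_of_nonneg (by omega) (by omega), zchoose_of_nonneg hn (by omega), zchoose_of_nonneg hn (by omega),
      show (n + 1).toNat = n.toNat + 1 by omega, show m.toNat = (m - 1).toNat + 1 by omega, Nat.choose_succ_succ']
    push_cast; ring
  by_cases hmn1 : m = n + 1
  · subst hmn1
    rw [zchoose_of_nonneg (by omega) (by omega), zchoose_eq_zero (Or.inr (by omega)),
      zchoose_of_nonneg hn (by omega), show n + 1 - 1 = n by ring, Nat.choose_self, Nat.choose_self]; simp
  · rw [zchoose_eq_zero (Or.inr (by omega)), zchoose_eq_zero (Or.inr (by omega)), zchoose_eq_zero (Or.inr (by omega))]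
    simp

/-- If `zchoose k p ≠ 0` then `0 ≤ p ≤ k`. -/
theorem le_of_zchoose_ne_zero {k p : ℤ} (h : zchoose k p ≠ 0) : 0 ≤ p ∧ p ≤ k := by
  by_contra hc
  exact h (zchoose_eq_zero (by omega))

/-- The summand relation behind `abs_Qcoeff_rel`. -/
theorem bzTerm_rel (p : Fin 7 → ℤ) (q : Fin 5 → ℤ) (hq2 : 0 ≤ q 2) (k₁ k₂ : ℤ) :
    bzTerm (Function.update p 3 (p 3 - 1)) (Function.update q 2 (q 2 + 1)) k₁ k₂ =
      bzTerm p q k₁ k₂ + bzTerm (Function.update p 3 (p 3 - 1)) q k₁ k₂ := by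
  unfold bzTerm
  simp only [Function.update_self, Function.update_of_ne, ne_eq, Fin.reduceEq, not_false_eq_true]
  by_cases h1 : zchoose k₁ (p 0) = 0
  · simp [h1]
  by_cases h2 : zchoose k₂ (p 6) = 0
  · simp [h2]
  have b1 := le_of_zchoose_ne_zero h1
  have b2 := le_of_zchoose_ne_zero h2
  rw [show k₁ + k₂ + (q 2 + 1) - p 0 - p 6 = (k₁ + k₂ + q 2 - p 0 - p 6) + 1 by ring,
    show p 3 - 1 + (q 2 + 1) - p 0 - p 6 = p 3 + q 2 - p 0 - p 6 by ring,
    zchoose_succ_left (by omega), show p 3 - 1 + q 2 - p 0 - p 6 = p 3 + q 2 - p 0 - p 6 - 1 by ring]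
  ring

/-- **The three-term relation of (17) in `(q₂, p₃)`** (0-based slots `q 2`, `p 3`), valid for `q₂ ≥ 0`. -/
theorem abs_Qcoeff_rel (p : Fin 7 → ℤ) (q : Fin 5 → ℤ) (hq2 : 0 ≤ q 2) :
    |Qcoeff (Function.update p 3 (p 3 - 1)) (Function.update q 2 (q 2 + 1))| =
      |Qcoeff p q| + |Qcoeff (Function.update p 3 (p 3 - 1)) q| := by
  rw [abs_Qcoeff, abs_Qcoeff, abs_Qcoeff]
  have e1 : (Function.update p 3 (p 3 - 1)) 1 = p 1 := by simp
  have e4 : (Function.update p 3 (p 3 - 1)) 4 = p 4 := by simp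
  have f0 : (Function.update q 2 (q 2 + 1)) 0 = q 0 := by simp
  have f3 : (Function.update q 2 (q 2 + 1)) 3 = q 3 := by simp
  rw [e1, e4, f0, f3, ← sum_add_distrib]
  refine sum_congr rfl fun k₁ _ => ?_
  rw [← sum_add_distrib]
  exact sum_congr rfl fun k₂ _ => bzTerm_rel p q hq2 k₁ k₂

/-- `|Q(p;q)| = 0` when the lower index `t₃ = p₃+q₂−p₀−p₆` of the central binomial is negative. -/
theorem abs_Qcoeff_eq_zero_of_neg (p : Fin 7 → ℤ) (q : Fin 5 → ℤ) (h : p 3 + q 2 - p 0 - p 6 < 0) : |Qcoeff p q| = 0 := by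
  rw [abs_Qcoeff]
  exact sum_eq_zero fun k₁ _ => sum_eq_zero fun k₂ _ => by
    simp [bzTerm, zchoose_eq_zero (n := k₁ + k₂ + q 2 - p 0 - p 6) (Or.inl h)]

/-! ## Bookkeeping of the dictionary under the relation -/

/-- `e(p[p₃ ↦ x]; q[q₂ ↦ y])` differs from `e(p;q)` only in slot `0`. -/
theorem eOfPQ_update (p : Fin 7 → ℤ) (q : Fin 5 → ℤ) (x y : ℤ) :
    eOfPQ (Function.update p 3 x) (Function.update q 2 y) =
      Function.update (eOfPQ p q) 0 (y - p 0 - p 6 + p 2 + p 4).toNat := by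
  funext k; fin_cases k <;> simp [eOfPQ]

/-- `e(p[p₃ ↦ x]; q)` differs from `e(p;q)` only in slot `0` (in fact not at all). -/
theorem eOfPQ_update' (p : Fin 7 → ℤ) (q : Fin 5 → ℤ) (x : ℤ) :
    eOfPQ (Function.update p 3 x) q = Function.update (eOfPQ p q) 0 (q 2 - p 0 - p 6 + p 2 + p 4).toNat := by
  funext k; fin_cases k <;> simp [eOfPQ]

/-- `t(p[p₃−1]; q[q₂+1]) = t(p;q)`. -/
theorem tOfPQ_update (p : Fin 7 → ℤ) (q : Fin 5 → ℤ) :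
    tOfPQ (Function.update p 3 (p 3 - 1)) (Function.update q 2 (q 2 + 1)) = tOfPQ p q := by
  funext k; fin_cases k <;> simp [tOfPQ]

/-- `t(p[p₃−1]; q) = t(p;q) − u_v`. -/
theorem tOfPQ_update' (p : Fin 7 → ℤ) (q : Fin 5 → ℤ) :
    tOfPQ (Function.update p 3 (p 3 - 1)) q = tOfPQ p q - tUnit 2 := by
  funext k; simp only [Pi.sub_apply]; fin_cases k <;> simp [tOfPQ, tUnit]; ring

/-! ## `|Q| = Gz` in twelve parameters, any sign of `e₁` -/

/-- Non-negative `e₁`: the landed polynomial bridge. -/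
theorem abs_Qcoeff_eq_Gz_of_nonneg (p : Fin 7 → ℤ) (q : Fin 5 → ℤ) (hp2 : 0 ≤ p 2) (hp4 : 0 ≤ p 4)
    (hq : ∀ j, 0 ≤ q j) (he1 : 0 ≤ q 2 - p 0 - p 6 + p 2 + p 4) :
    |Qcoeff p q| = Gz (q 2 - p 0 - p 6 + p 2 + p 4) (eOfPQ p q) (tOfPQ p q) := by
  rw [abs_Qcoeff_eq_G p q hp2 hp4 hq he1, show q 2 - p 0 - p 6 + p 2 + p 4 = ((eOfPQ p q 0 : ℕ) : ℤ) by
    simp [eOfPQ]; omega, Gz_natCast]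

/-- Negative `e₁ = −n`: double induction (on `n`, then on `t₃`) using `abs_Qcoeff_rel` and `Gz_succ` backwards. -/
theorem abs_Qcoeff_eq_Gz_neg (n : ℕ) : ∀ (p : Fin 7 → ℤ) (q : Fin 5 → ℤ), 0 ≤ p 2 → 0 ≤ p 4 → (∀ j, 0 ≤ q j) →
    q 2 - p 0 - p 6 + p 2 + p 4 = -(n : ℤ) → |Qcoeff p q| = Gz (-(n : ℤ)) (eOfPQ p q) (tOfPQ p q) := by
  induction n with
  | zero =>
    intro p q hp2 hp4 hq he
    have h := abs_Qcoeff_eq_Gz_of_nonneg p q hp2 hp4 hq (by omega)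
    rw [he] at h; exact_mod_cast h
  | succ n ih =>
    suffices H : ∀ (M : ℕ) (p : Fin 7 → ℤ) (q : Fin 5 → ℤ), 0 ≤ p 2 → 0 ≤ p 4 → (∀ j, 0 ≤ q j) →
        q 2 - p 0 - p 6 + p 2 + p 4 = -((n + 1 : ℕ) : ℤ) → p 3 + q 2 - p 0 - p 6 < M →
        |Qcoeff p q| = Gz (-((n + 1 : ℕ) : ℤ)) (eOfPQ p q) (tOfPQ p q) from
      fun p q hp2 hp4 hq he => H ((p 3 + q 2 - p 0 - p 6).toNat + 1) p q hp2 hp4 hq he (by omega)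
    intro M
    induction M with
    | zero =>
      intro p q _ _ _ _ ht
      rw [abs_Qcoeff_eq_zero_of_neg p q (by omega), Gz_eq_zero_of_neg _ _ (j := 2) (by simp [tOfPQ]; omega)]
    | succ M ihM =>
      intro p q hp2 hp4 hq he ht
      have hs : -((n + 1 : ℕ) : ℤ) + 1 = -(n : ℤ) := by push_cast; ring
      have hrel := abs_Qcoeff_rel p q (hq 2)
      have h1 : |Qcoeff (Function.update p 3 (p 3 - 1)) (Function.update q 2 (q 2 + 1))| =
          Gz (-(n : ℤ)) (eOfPQ (Function.update p 3 (p 3 - 1)) (Function.update q 2 (q 2 + 1)))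
            (tOfPQ (Function.update p 3 (p 3 - 1)) (Function.update q 2 (q 2 + 1))) :=
        ih _ _ (by simpa using hp2) (by simpa using hp4)
          (by intro j
              by_cases hj : j = 2
              · subst hj; simp only [Function.update_self]; have := hq 2; omega
              · rw [Function.update_of_ne hj]; exact hq j)
          (by simp; omega)
      have h2 : |Qcoeff (Function.update p 3 (p 3 - 1)) q| = Gz (-((n + 1 : ℕ) : ℤ))
          (eOfPQ (Function.update p 3 (p 3 - 1)) q) (tOfPQ (Function.update p 3 (p 3 - 1)) q) :=
        ihM _ q (by simpa using hp2) (by simpa using hp4) hq (by simp; omega) (by simp; omega)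
      rw [eOfPQ_update, tOfPQ_update, Gz_update0] at h1
      rw [eOfPQ_update', tOfPQ_update', Gz_update0] at h2
      have hG := Gz_succ (-((n + 1 : ℕ) : ℤ)) (eOfPQ p q) (tOfPQ p q)
      rw [hs] at hG
      linarith

/-- **`|Q(p;q)| = Gz e₁ (e(p,q)) (t(p,q))` for `p₂, p₄ ≥ 0`, `q ≥ 0`, ANY sign of `e₁ = q₂−p₀−p₆+p₂+p₄`.** -/
theorem abs_Qcoeff_eq_Gz (p : Fin 7 → ℤ) (q : Fin 5 → ℤ) (hp2 : 0 ≤ p 2) (hp4 : 0 ≤ p 4) (hq : ∀ j, 0 ≤ q j) :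
    |Qcoeff p q| = Gz (q 2 - p 0 - p 6 + p 2 + p 4) (eOfPQ p q) (tOfPQ p q) := by
  obtain ⟨n, h | h⟩ := Int.eq_nat_or_neg (q 2 - p 0 - p 6 + p 2 + p 4)
  · exact abs_Qcoeff_eq_Gz_of_nonneg p q hp2 hp4 hq (by omega)
  · rw [h]; exact abs_Qcoeff_eq_Gz_neg n p q hp2 hp4 hq h

/-- **The bridge on the WHOLE numerator cone**: `|Q(a)| = Gz (h₂₇ a) (e(a)) (t(a))` whenever `bzNum a ≥ 0`. -/
theorem abs_QOf_eq_Gz (a : Fin 8 → ℤ) (hA : ∀ i, 0 ≤ bzNum a i) :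
    |QOf a| = Gz (a 3 + a 6 + 2 * a 7 - a 1 - a 2 - a 5) (eOfA a) (tOfA a) := by
  have a0 := hA 0; have a1 := hA 1; have a3 := hA 3; have a4 := hA 4; have a5 := hA 5; have a6 := hA 6
  have a7 := hA 7
  simp [bzNum] at a0 a1 a3 a4 a5 a6 a7
  have hp2 : 0 ≤ pOf a 2 := by simp [pOf]; omega
  have hp4 : 0 ≤ pOf a 4 := by simp [pOf]; omega
  have hq : ∀ j, 0 ≤ qOf a j := by intro j; fin_cases j <;> simp [qOf] <;> omega
  have he1 : qOf a 2 - pOf a 0 - pOf a 6 + pOf a 2 + pOf a 4 = a 3 + a 6 + 2 * a 7 - a 1 - a 2 - a 5 := by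
    simp [pOf, qOf]; ring
  have he : eOfPQ (pOf a) (qOf a) = Function.update (eOfA a) 0 (eOfPQ (pOf a) (qOf a) 0) := by
    funext k; fin_cases k <;> simp [eOfPQ, eOfA, pOf, qOf]
  have ht : tOfPQ (pOf a) (qOf a) = tOfA a := by
    funext k; fin_cases k <;> simp [tOfPQ, tOfA, pOf, qOf] <;> ring
  unfold QOf
  rw [abs_Qcoeff_eq_Gz _ _ hp2 hp4 hq, he1, he, Gz_update0, ht]

end DualQ

end Summit.KontsevichZagierPeriods.Zeta5Search.Families.Cellular
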